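import Summits.Ventures.GridStability.Models.SMIBK13Corollaries
import Literature.MathematicalPhysics.PowerSystems.SMIBSynchronizationDichotomy

/-!
# GridStability/Models/SMIBK13Dichotomy — «G1.SMIB-DICHOTOMY-THM» candidate: the complete phase portrait of «SMIB-K13post-D10»
# (typed by gridfusion-lit-1 g8 as a cross-check, sha16 bbad110ce502c581; FILED VERBATIM — title lines only — by gridfusion-model-1 g5,
# owner of the K13 instance files; lit-1 2026-08-27T11:43:41Z).

For the instance of record «SMIB-K13post-D10» (`K13postD10.toLit = ⟨7/377, 10/377, 79912287/88791425, 689/625⟩`),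
the complete phase portrait of lit-1's `Literature/MathematicalPhysics/PowerSystems/SMIBSynchronizationDichotomy.lean`
(Tricomi III; Leonov2001 Ch. 4 §4.2 Thm 4.1 + case 1); AndronovVittKhaikin1966 Ch. VII §3 Fig. 338) instantiates with the
cosine fence `a = 15`, `b = 259753/65625` of `SMIBAsynchronousRegimeK13` (#67):
(1) `K13postD10_tendsto_equilibrium_or_tendsto_angle_atTop` — EVERY global post-fault motion of `K13postD10`, from ANY
initial state, either converges to an equilibrium point `(θe, 0)` or slips poles for ever (`δ → +∞`) — no third behaviour;
(2) `K13postD10_exists_speed_pos_of_tendsto_angle_atTop` — in the second case the speed deviation is negative on an initial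
interval `[0, T)` and POSITIVE for every `t > T`;
(3) `K13postD10_tendsto_equilibrium_or_tendsto_runningProfile` — with THE `2π`-periodic running profile `ζ ≥ 15 + (259753/65625) cos δ`
of #67: every motion either converges to an equilibrium point or converges to the asynchronous regime (`δ → +∞`, `ω − ζ(δ) → 0`).
THREE COLUMNS: CERTIFIED for MODEL M′ = classical SMIB «SMIB-K13post-D10» (MV-1 + MV-P + MV-KD), CLASS C = ALL initial states;
NOT CLAIMED: which alternative from a given state (that is what the ROA rows #19/#26 and the non-return region decide), nothing
about a machine (out-of-step protection trips first). [cite: Leonov2001, Ch. 4 §4.2 Thm 4.1; AndronovVittKhaikin1966, Ch. VII §3; Kundur1994, Ex. 13.1]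
-/

noncomputable section

open Real Set Filter Topology

namespace Summit.Ventures.GridStability.Models.SMIB

/-- **Dichotomy for «SMIB-K13post-D10».** Every global post-fault motion either converges to an equilibrium point or has
`δ(t) → +∞`. [cite: Leonov2001, Ch. 4 §4.2 Thm 4.1 and case 1); Kundur1994, Ex. 13.1] -/
theorem K13postD10_tendsto_equilibrium_or_tendsto_angle_atTop {X : ℝ → ℝ × ℝ}
    (hX : ∀ S : ℝ, K13postD10.IsSolutionOn X (Icc 0 S)) :
    (∃ θe : ℝ, K13postD10.toLit.IsEquilibriumAngle θe ∧ Tendsto X atTop (𝓝 (θe, 0))) ∨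
      Tendsto (fun t => (X t).1) atTop atTop := by
  have hM : 0 < K13postD10.toLit.M := by rw [K13postD10_toLit]; norm_num
  have hD : 0 < K13postD10.toLit.D := by rw [K13postD10_toLit]; norm_num
  have hPmax : 0 < K13postD10.toLit.Pmax := by rw [K13postD10_toLit]; norm_num
  have heq : K13postD10.toLit.IsEquilibriumAngle deltaK13 :=
    (toLit_isEquilibriumAngle_iff K13postD10_γ deltaK13).2 K13postD10_isEquilibrium
  have hXlit : ∀ S : ℝ, ∀ t ∈ Icc 0 S,
      HasDerivWithinAt X (K13postD10.toLit.vectorField (X t)) (Icc 0 S) t :=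
    fun S => (isSolutionOn_iff_toLit K13postD10_γ X _).1 (hX S)
  exact K13postD10.toLit.tendsto_equilibrium_or_tendsto_angle_atTop hM hD hPmax heq deltaK13_pos
    deltaK13_lt_pi_div_two hXlit

/-- **Sign of the speed on a pole-slipping motion of «SMIB-K13post-D10».** [cite: Leonov2001, Ch. 4 §4.2, alternative 1) (Fig. 4.24)] -/
theorem K13postD10_exists_speed_pos_of_tendsto_angle_atTop {X : ℝ → ℝ × ℝ}
    (hX : ∀ S : ℝ, K13postD10.IsSolutionOn X (Icc 0 S))
    (hesc : Tendsto (fun t => (X t).1) atTop atTop) :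
    ∃ T : ℝ, 0 ≤ T ∧ (∀ t, 0 ≤ t → t < T → (X t).2 < 0) ∧ ∀ t, T < t → 0 < (X t).2 := by
  have hM : 0 < K13postD10.toLit.M := by rw [K13postD10_toLit]; norm_num
  have hD : 0 ≤ K13postD10.toLit.D := by rw [K13postD10_toLit]; norm_num
  have hPmax : 0 < K13postD10.toLit.Pmax := by rw [K13postD10_toLit]; norm_num
  have heq : K13postD10.toLit.IsEquilibriumAngle deltaK13 :=
    (toLit_isEquilibriumAngle_iff K13postD10_γ deltaK13).2 K13postD10_isEquilibrium
  have hXlit : ∀ S : ℝ, ∀ t ∈ Icc 0 S,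
      HasDerivWithinAt X (K13postD10.toLit.vectorField (X t)) (Icc 0 S) t :=
    fun S => (isSolutionOn_iff_toLit K13postD10_γ X _).1 (hX S)
  exact K13postD10.toLit.exists_speed_pos_of_tendsto_angle_atTop hM hD hPmax heq deltaK13_pos
    deltaK13_lt_pi_div_two hXlit hesc

/-- **Complete phase portrait of «SMIB-K13post-D10».** There is a `2π`-periodic running profile `ζ ≥ 15 + (259753/65625) cos δ`
(the asynchronous regime of #67) such that EVERY global post-fault motion either converges to an equilibrium point or satisfies
`δ → +∞` and `ω − ζ(δ) → 0`. [cite: AndronovVittKhaikin1966, Ch. VII §3 case II (Fig. 338); Leonov2001, Ch. 4 §4.2 Thm 4.1, case 1)] -/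
theorem K13postD10_tendsto_equilibrium_or_tendsto_runningProfile :
    ∃ ζ : ℝ → ℝ, (∀ θ, HasDerivAt ζ (K13postD10.toLit.accel θ (ζ θ) / ζ θ) θ) ∧
      (∀ θ, ζ (θ + 2 * π) = ζ θ) ∧ (∀ θ, 15 + (259753 / 65625 : ℝ) * Real.cos θ ≤ ζ θ) ∧
      ∀ X : ℝ → ℝ × ℝ, (∀ S : ℝ, K13postD10.IsSolutionOn X (Icc 0 S)) →
        (∃ θe : ℝ, K13postD10.toLit.IsEquilibriumAngle θe ∧ Tendsto X atTop (𝓝 (θe, 0))) ∨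
          (Tendsto (fun t => (X t).1) atTop atTop ∧
            Tendsto (fun t => (X t).2 - ζ (X t).1) atTop (𝓝 0)) := by
  have hM : 0 < K13postD10.toLit.M := by rw [K13postD10_toLit]; norm_num
  have hD : 0 < K13postD10.toLit.D := by rw [K13postD10_toLit]; norm_num
  have hPmax : 0 < K13postD10.toLit.Pmax := by rw [K13postD10_toLit]; norm_num
  have heq : K13postD10.toLit.IsEquilibriumAngle deltaK13 :=
    (toLit_isEquilibriumAngle_iff K13postD10_γ deltaK13).2 K13postD10_isEquilibrium
  obtain ⟨ζ, h1, h2, h3, h4⟩ :=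
    K13postD10.toLit.tendsto_equilibrium_or_tendsto_runningProfile_of_cosineFence hM hD hPmax heq
      deltaK13_pos deltaK13_lt_pi_div_two (a := 15) (b := 259753 / 65625) (by norm_num) (by norm_num)
      K13postD10_fence_product K13postD10_fence_inequality
  refine ⟨ζ, h1, h2, h3, fun X hX => h4 X ?_⟩
  exact fun S => (isSolutionOn_iff_toLit K13postD10_γ X _).1 (hX S)

end Summit.Ventures.GridStability.Models.SMIB

end
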